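import Summits.QuantumFields.YangMills.Theorems.UnitScaleTiltProp7LocMinOfGaugedRows
import Summits.QuantumFields.YangMills.Theorems.UnitScaleTiltProp7HessWOfFibreCoreT3
import HarnessLib

/-!
# Route `UnitScaleTilt`, crux K1 child «MinimiserStabilityRegPr» (stmt-QuantumFields-19200) — THE GROWTH-SIDE DOOR IN (116) CURRENCY ON THE UNTWISTED FIBRE:
# E′ ⇐ CHART_W ∧ `e^{iD}W ∈ 𝔅_k(V)` ∧ SLICE `DIV ≤ ζK + δM` ∧ JOINT MOD COARSE GAUGE `≤ C₁ℓ⁻¹M + C₂ℓ(K + DIV)` — HESS_W′ DISCHARGED by ✓`hessW_curl_div_of_mem_fibre_T3`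

Cell `ym3-torus` ∕ fleet seat `ym-ust-19200-p1` (gen 14, route-R lead ∕ (n3) namer).  THEOREMS ONLY (0 `def`, 0 `sorry`); `--supports stmt-QuantumFields-19200`, count-neutral.
YM₃ on T³ is a ladder rung (R3), not the Clay problem; nothing here claims the stub, the crux, d = 4 or the mass gap; E′ is NOT closed by this file.

WHY.  After ✓`Prop7LocMinOfGaugedRows` (JOINT row mod coarse gauge) the growth side's displayed rows per competitor were CHART_W, HESS_W′ `κM ≤ K` and JOINT `≤ C₁ℓ⁻¹M + C₂ℓK`.
Two currency facts located on the bus (★routeR-w3 g4 `LOCATE-R1-DIVBUDGET`, this seat 15:11Z∕15:39Z): (i) the (n3) supplier chain (✓∕⧗ `…FibreLogRatioGaugedL1` → `…LogRemainderMass`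
→ `…JointRowOfLevelMasses` over ✓`Prop7FibreLevelMass*` + ✓`…T3Letters.sum_normSq_covIterLambda_le_level`) delivers the JOINT row in `(M, CURL₀ + DIV₀)` currency, i.e.
`≤ C₁ℓ⁻¹M + C₂ℓ(K + DIV)`; (ii) HESS_W′ is a THEOREM in the (116) currency `κM ≤ K + ¼DIV` for every chart point ON THE SAME (0.4)-FIBRE (✓`hessW_curl_div_of_mem_fibre_T3`,
★routeR-w3 g3, gauge-free, `κ = ℓ⁻²∕(128(18 + 537600L⁴))`).  Both leave ONE residual per competitor: the SLICE's divergence budget `DIV ≤ ζK + δM` (zero on the covariant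
Landau slice; LEMMA H on the centre-harmonic slice; NOT small on print's (1.38) block-mean slice against the fibre of record — the lane's twisted∕untwisted decision).  This
file folds that budget into both rows: `κ′ = (κ − δ∕4)∕(1 + ζ∕4)`, `C₁′ = C₁ + C₂ℓ²δ`, `C₂′ = C₂(1 + ζ)`, and runs ✓`linRow_of_QRows` with the gauged pairing
✓`abs_lin_le_sum_norm_trueLinIter_sub_coarseGauge`.  With `s = s₀ℓ⁻¹`, `δ = δ₀ℓ⁻²` every window is `L`-only.

WHAT IS PROVED (ns `…Theorems.Prop7LocMinOfGaugedRows116`; T³, `SU(2)`).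
* §1 ★★ `isMinOn_regFibrePr_of_gaugedRows116_at` — one member, one datum: rows CHART_W, HESS116 (`κM ≤ K + ¼DIV`, displayed), SLICE (`DIV ≤ ζK + δM`), JOINT MOD COARSE GAUGE
  in `(K + DIV)` currency, windows `4s ≤ 1`, `2eC₂(1+ζ) ≤ ⅛`, `15552s² + 216·regThreshold(e) + 2e(C₁ + C₂ℓ²δ)ℓ⁻² ≤ κ′∕8` ⇒ `W` minimises over (6)(e) ∩ 𝔅_k(V).
* §2 ★★★ `isMinOn_regFibrePr_of_fibreRows_at` — the same with HESS116 DISCHARGED (`κ := ℓ⁻²∕(128(18 + 537600L⁴))`, windows `10¹⁴L⁹e ≤ 1`, `4·10¹¹L⁹(ℓs) ≤ 1`): displayed per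
  competitor = chart, `e^{iD}W ∈ 𝔅_k(V)` (UNTWISTED fibre membership), SLICE, JOINT mod coarse gauge.
HONEST SCOPE.  Bookkeeping over landed letters.  DISPLAYED, not proved: CHART_W with the untwisted membership ([Balaban1985RegularSpaces] Thm 2 ∕ [Balaban1985Variational] (47)–(48)
at the critical background — the Σ-twisted (1.37)^cov chart of record does NOT supply `e^{iD}W ∈ 𝔅_k(V)`, see the bus 15:39Z), the SLICE budget, and the JOINT remainder row mod
coarse gauge ((n3) files F2–F5).

References: T. Bałaban, CMP 102 (1985) 277–309 [Balaban1985Variational] ((6) p.278, (14) p.280, (47)–(48) pp.285–286, (116) p.295, (141)–(143), Prop. 7 p.299);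
CMP 99 (1985) 389–434 [Balaban1985BackgroundPropagators] ((3.9)–(3.11) p.392, Thm 3.11 p.416); CMP 99 (1985) 75–102 [Balaban1985RegularSpaces] ((1.29) p.81, (1.38) p.82, Thm 2 p.83);
CMP 98 (1985) 17–51 [Balaban1985Averaging] ((11) p.19, (122)–(125) p.36).
-/

set_option autoImplicit false
noncomputable section

open scoped BigOperators Matrix.Norms.L2Operator Matrix Topology
open Filter

namespace Summit.QuantumFields.YangMills.Theorems.Prop7LocMinOfGaugedRows116

open Literature.MathematicalPhysics.QuantumFieldTheory.Balaban1983to89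
open Literature.MathematicalPhysics.QuantumFieldTheory.Balaban1983to89.T3ContinuumYM3Torus
open Literature.MathematicalPhysics.QuantumFieldTheory.Balaban1983to89.T3UnitLawDensityEML (ℰp)
open Literature.MathematicalPhysics.QuantumFieldTheory.Balaban1983to89.T3ConstrainedMinimiser
open Literature.MathematicalPhysics.QuantumFieldTheory.Balaban1983to89.T3Thm1Carrier
open Literature.MathematicalPhysics.QuantumFieldTheory.Balaban1983to89.T3PrintedRegularMinimiser
open Literature.MathematicalPhysics.QuantumFieldTheory.Balaban1983to89.T3RegularMinimiser
open Literature.MathematicalPhysics.QuantumFieldTheory.Balaban1983to89.T3Thm1CarrierNative (IsCritR2)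
open Literature.MathematicalPhysics.QuantumFieldTheory.Balaban1983to89.T3SectALandauChart (emb15 CloseAvg pos_of_regPr)
open T4Continuum BlockAveraging AveragingRT ExpMeanLog BlockAveragingEMLLinearised BlockAveragingEMLLinearisedBackground BlockAveragingEMLProp2
open Summit.QuantumFields.YangMills.Theorems.Prop7TPrint (expHermField)
open Summit.QuantumFields.YangMills.Theorems.Prop7LocMinOfJointRow (isMinOn_regFibrePr_of_linRows_at linRow_of_QRows)
open Summit.QuantumFields.YangMills.Theorems.Prop7FirstVariationExactPairing (abs_lin_le_sum_norm_trueLinIter tower_loop_rows_of_regPr gaugeDir_mem_su2)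
open Summit.QuantumFields.YangMills.Theorems.Prop7CurvedLandauRowA (exists_trueLinIter_family)
open Summit.QuantumFields.YangMills.Theorems.Prop7LocMinOfMultiplierRows (I_smul_mem_skewAdjoint trace_I_smul_eq_zero scaled_smallness_mult)
open Summit.QuantumFields.YangMills.Theorems.Prop7TrueLinPureGaugeIter (trueLinIter_sub trueLinIter_pureGauge)
open Summit.QuantumFields.YangMills.Theorems.Prop7LinGaugeInvariance (lin_sub_gaugeDir_eq)
open Summit.QuantumFields.YangMills.Theorems.Prop7LocMinOfGaugedRows (abs_lin_le_sum_norm_trueLinIter_sub_coarseGauge)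
open Summit.QuantumFields.YangMills.Theorems.Prop7HessWOfFibreCoreT3 (hessW_curl_div_of_mem_fibre_T3)
open B9Eq39Adjoint (divB)
open B9TorusCalculus (torusT)
open B10Eq27TorusAxialLog (unitsField toUField)
open B15DeterminingSets (embIter)
open B5Eq118OneStroke (iterBlockOf)
open Node00 (iterBlockOf_embIter_eq)

/-! ## §1 One member, one datum: the door in (116) currency -/

set_option maxHeartbeats 400000 in
/-- ★★ **E′ AT A DATUM FROM CHART_W ∧ HESS_W′ IN (116) CURRENCY ∧ SLICE BUDGET ∧ THE JOINT ROW MODULO COARSE GAUGE IN (CURL + DIV) CURRENCY.**  `W ∈ (6)(e) ∩ 𝔅_k(V)`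
R2-critical, `10¹⁰L⁶e ≤ 1`; `Q` any recursion family at `W` (displayed, zero content).  Every competitor `W′ ∈ (6)(e) ∩ 𝔅_k(V)` comes with a Hermitian-traceless `D`,
`‖D(b)‖ ≤ s`, `A(W′) = A(e^{iD}W)` and THREE displayed rows in the letters `M = Σ‖D‖²`, `K = Σ_p‖ℒ_p(D)‖²`, `DIV = Σ_xΣ_jk|(D^*_W(iD))(x)_jk|²` (the (116) divergence letter of
✓`Prop7HessWOfFibreCoreT3.hessW_curl_div_of_mem_fibre_T3`): HESS116 `κM ≤ K + ¼DIV` (proved gauge-free on the (0.4)-fibre, `κ = ℓ⁻²∕(128(18 + 537600L⁴))`, by that theorem),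
SLICE `DIV ≤ ζK + δM` (the competitor slice's divergence budget — zero on the covariant Landau slice, LEMMA H on the centre-harmonic slice; the ONE residual row of the growth
side), and JOINT MOD COARSE GAUGE `∃ μ ∈ 𝔰𝔲(2)^{(K−n)-sites}: Σ_c‖Q (K−n) (iD) c − (μ c₋ − W̄ c·μ c₊·(W̄ c)*)‖ ≤ C₁ℓ⁻¹M + C₂ℓ(K + DIV)` (the (n3) suppliers' natural
currency: level masses against `CURL₀ + DIV₀`).  If `4s ≤ 1`, `2eC₂(1+ζ) ≤ ⅛` and `15552s² + 216·regThreshold(e) + 2e(C₁ + C₂ℓ²δ)ℓ⁻² ≤ κ′∕8` with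
`κ′ = (κ − δ∕4)∕(1 + ζ∕4)`, then `W` minimises the Wilson action over (6)(e) ∩ 𝔅_k(V).  Proof: fold SLICE into HESS116 (`κ′M ≤ K`) and into JOINT (`C₁′ = C₁ + C₂ℓ²δ`,
`C₂′ = C₂(1+ζ)`), then ✓`isMinOn_regFibrePr_of_linRows_at` ∘ ✓`linRow_of_QRows` with the gauged pairing ✓`abs_lin_le_sum_norm_trueLinIter_sub_coarseGauge`.
[cite: Balaban1985Variational, (141)-(143) p.299, (116) p.295, (47)-(48) pp.285-286, (6) p.278; Balaban1985BackgroundPropagators, (3.9)-(3.11) p.392, Thm 3.11 p.416] -/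
theorem isMinOn_regFibrePr_of_gaugedRows116_at (F : T3Family) {n K : ℕ} (h : n ≤ K) {e s κ ζ δ C₁ C₂ : ℝ} (hζ : 0 ≤ ζ) (hC₂ : 0 ≤ C₂)
    (V : GaugeField (F.P n) 0 (Matrix.specialUnitaryGroup (Fin 2) ℂ)) {W : GaugeField (F.P K) 0 (Matrix.specialUnitaryGroup (Fin 2) ℂ)}
    (hW : IsCritR2 F n K h V W) (hWe : W ∈ regFibrePr F n K h e V) (he : 10 ^ 10 * (F.L : ℝ) ^ 6 * e ≤ 1)
    (Q : (k : ℕ) → (PBond (F.P K) 0 → Matrix (Fin 2) (Fin 2) ℂ) → PBond (F.P K) k → Matrix (Fin 2) (Fin 2) ℂ) (hQ0 : ∀ Y, Q 0 Y = Y)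
    (hQs : ∀ (k : ℕ) (Y : PBond (F.P K) 0 → Matrix (Fin 2) (Fin 2) ℂ) (c : PBond (F.P K) (k + 1)), Q (k + 1) Y c
      = fderiv ℂ (eml : (Idx (F.P K) → Matrix (Fin 2) (Fin 2) ℂ) → Matrix (Fin 2) (Fin 2) ℂ)
            (fun i => ((loopHol (Averaging.iter (fun i => blockAvg (P := F.P K) (j := i) (expMeanLogSU (n := Fin 2))) k W) c i :
              Matrix.specialUnitaryGroup (Fin 2) ℂ) : Matrix (Fin 2) (Fin 2) ℂ))
            (fun i => covWalkSum (Averaging.iter (fun i => blockAvg (P := F.P K) (j := i) (expMeanLogSU (n := Fin 2))) k W) (Q k Y)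
                (walk (emb c.src) (loopWord (F.P K).L c.dir (off i.1) i.2.1 i.2.2))
              * ((loopHol (Averaging.iter (fun i => blockAvg (P := F.P K) (j := i) (expMeanLogSU (n := Fin 2))) k W) c i :
                Matrix.specialUnitaryGroup (Fin 2) ℂ) : Matrix (Fin 2) (Fin 2) ℂ))
            * star ((corr (expMeanLogSU (n := Fin 2)) (Averaging.iter (fun i => blockAvg (P := F.P K) (j := i) (expMeanLogSU (n := Fin 2))) k W) c :
                Matrix.specialUnitaryGroup (Fin 2) ℂ) : Matrix (Fin 2) (Fin 2) ℂ)
          + ((corr (expMeanLogSU (n := Fin 2)) (Averaging.iter (fun i => blockAvg (P := F.P K) (j := i) (expMeanLogSU (n := Fin 2))) k W) c :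
                Matrix.specialUnitaryGroup (Fin 2) ℂ) : Matrix (Fin 2) (Fin 2) ℂ)
            * covWalkSum (Averaging.iter (fun i => blockAvg (P := F.P K) (j := i) (expMeanLogSU (n := Fin 2))) k W) (Q k Y)
                (walk (emb c.src) (List.replicate (F.P K).L (c.dir, true)))
            * star ((corr (expMeanLogSU (n := Fin 2)) (Averaging.iter (fun i => blockAvg (P := F.P K) (j := i) (expMeanLogSU (n := Fin 2))) k W) c :
                Matrix.specialUnitaryGroup (Fin 2) ℂ) : Matrix (Fin 2) (Fin 2) ℂ))
    (hrows : ∀ W' : GaugeField (F.P K) 0 (Matrix.specialUnitaryGroup (Fin 2) ℂ), W' ∈ regFibrePr F n K h e V →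
        ∃ (D : PBond (F.P K) 0 → Matrix (Fin 2) (Fin 2) ℂ),
          (∀ b : PBond (F.P K) 0, (D b).IsHermitian ∧ Matrix.trace (D b) = 0) ∧ (∀ b : PBond (F.P K) 0, ‖D b‖ ≤ s) ∧
          wilsonAction4 W' = wilsonAction4 (emb15 W (expHermField D)) ∧
          κ * ∑ b : PBond (F.P K) 0, ‖D b‖ ^ 2
            ≤ (∑ p : Plaq (F.P K) 0, ‖((Complex.I • D ⟨p.src, p.μ⟩) + ((W ⟨p.src, p.μ⟩ : Matrix (Fin 2) (Fin 2) ℂ) * (Complex.I • D ⟨p.src.shift p.μ, p.ν⟩) * star (W ⟨p.src, p.μ⟩ : Matrix (Fin 2) (Fin 2) ℂ))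
            - (((W ⟨p.src, p.μ⟩ * W ⟨p.src.shift p.μ, p.ν⟩ * (W ⟨p.src.shift p.ν, p.μ⟩)⁻¹ : Matrix.specialUnitaryGroup (Fin 2) ℂ) : Matrix (Fin 2) (Fin 2) ℂ) * (Complex.I • D ⟨p.src.shift p.ν, p.μ⟩) * star ((W ⟨p.src, p.μ⟩ * W ⟨p.src.shift p.μ, p.ν⟩ * (W ⟨p.src.shift p.ν, p.μ⟩)⁻¹ : Matrix.specialUnitaryGroup (Fin 2) ℂ) : Matrix (Fin 2) (Fin 2) ℂ))
            - (((GaugeField.plaqHol W p : Matrix.specialUnitaryGroup (Fin 2) ℂ) : Matrix (Fin 2) (Fin 2) ℂ) * (Complex.I • D ⟨p.src, p.ν⟩) * star ((GaugeField.plaqHol W p : Matrix.specialUnitaryGroup (Fin 2) ℂ) : Matrix (Fin 2) (Fin 2) ℂ)))‖ ^ 2)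
              + (1 / 4) * (∑ x : Site (F.P K) 0, ∑ j : Fin 2, ∑ k : Fin 2,
            ‖(divB (torusT (F.P K) 0) (fun κ z => unitsField (toUField W) ⟨z, κ⟩) (fun κ z => Complex.I • D ⟨z, κ⟩) x) j k‖ ^ 2) ∧
          (∑ x : Site (F.P K) 0, ∑ j : Fin 2, ∑ k : Fin 2,
            ‖(divB (torusT (F.P K) 0) (fun κ z => unitsField (toUField W) ⟨z, κ⟩) (fun κ z => Complex.I • D ⟨z, κ⟩) x) j k‖ ^ 2)
            ≤ ζ * (∑ p : Plaq (F.P K) 0, ‖((Complex.I • D ⟨p.src, p.μ⟩) + ((W ⟨p.src, p.μ⟩ : Matrix (Fin 2) (Fin 2) ℂ) * (Complex.I • D ⟨p.src.shift p.μ, p.ν⟩) * star (W ⟨p.src, p.μ⟩ : Matrix (Fin 2) (Fin 2) ℂ))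
            - (((W ⟨p.src, p.μ⟩ * W ⟨p.src.shift p.μ, p.ν⟩ * (W ⟨p.src.shift p.ν, p.μ⟩)⁻¹ : Matrix.specialUnitaryGroup (Fin 2) ℂ) : Matrix (Fin 2) (Fin 2) ℂ) * (Complex.I • D ⟨p.src.shift p.ν, p.μ⟩) * star ((W ⟨p.src, p.μ⟩ * W ⟨p.src.shift p.μ, p.ν⟩ * (W ⟨p.src.shift p.ν, p.μ⟩)⁻¹ : Matrix.specialUnitaryGroup (Fin 2) ℂ) : Matrix (Fin 2) (Fin 2) ℂ))
            - (((GaugeField.plaqHol W p : Matrix.specialUnitaryGroup (Fin 2) ℂ) : Matrix (Fin 2) (Fin 2) ℂ) * (Complex.I • D ⟨p.src, p.ν⟩) * star ((GaugeField.plaqHol W p : Matrix.specialUnitaryGroup (Fin 2) ℂ) : Matrix (Fin 2) (Fin 2) ℂ)))‖ ^ 2)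
              + δ * ∑ b : PBond (F.P K) 0, ‖D b‖ ^ 2 ∧
          ∃ μ : Site (F.P K) (K - n) → Matrix (Fin 2) (Fin 2) ℂ, (∀ y, μ y ∈ skewAdjoint (Matrix (Fin 2) (Fin 2) ℂ) ∧ (μ y).trace = 0) ∧
          ∑ c : PBond (F.P K) (K - n), ‖Q (K - n) (fun b => Complex.I • D b) c
              - (μ c.src
                - ((Averaging.iter (fun i => blockAvg (P := F.P K) (j := i) (expMeanLogSU (n := Fin 2))) (K - n) W c : Matrix.specialUnitaryGroup (Fin 2) ℂ) :
                    Matrix (Fin 2) (Fin 2) ℂ) * μ c.tgt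
                  * star ((Averaging.iter (fun i => blockAvg (P := F.P K) (j := i) (expMeanLogSU (n := Fin 2))) (K - n) W c : Matrix.specialUnitaryGroup (Fin 2) ℂ) :
                    Matrix (Fin 2) (Fin 2) ℂ))‖
            ≤ C₁ * ((F.L : ℝ) ^ (K - n))⁻¹ * ∑ b : PBond (F.P K) 0, ‖D b‖ ^ 2
              + C₂ * (F.L : ℝ) ^ (K - n) * ((∑ p : Plaq (F.P K) 0, ‖((Complex.I • D ⟨p.src, p.μ⟩) + ((W ⟨p.src, p.μ⟩ : Matrix (Fin 2) (Fin 2) ℂ) * (Complex.I • D ⟨p.src.shift p.μ, p.ν⟩) * star (W ⟨p.src, p.μ⟩ : Matrix (Fin 2) (Fin 2) ℂ))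
            - (((W ⟨p.src, p.μ⟩ * W ⟨p.src.shift p.μ, p.ν⟩ * (W ⟨p.src.shift p.ν, p.μ⟩)⁻¹ : Matrix.specialUnitaryGroup (Fin 2) ℂ) : Matrix (Fin 2) (Fin 2) ℂ) * (Complex.I • D ⟨p.src.shift p.ν, p.μ⟩) * star ((W ⟨p.src, p.μ⟩ * W ⟨p.src.shift p.μ, p.ν⟩ * (W ⟨p.src.shift p.ν, p.μ⟩)⁻¹ : Matrix.specialUnitaryGroup (Fin 2) ℂ) : Matrix (Fin 2) (Fin 2) ℂ))
            - (((GaugeField.plaqHol W p : Matrix.specialUnitaryGroup (Fin 2) ℂ) : Matrix (Fin 2) (Fin 2) ℂ) * (Complex.I • D ⟨p.src, p.ν⟩) * star ((GaugeField.plaqHol W p : Matrix.specialUnitaryGroup (Fin 2) ℂ) : Matrix (Fin 2) (Fin 2) ℂ)))‖ ^ 2)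
                + (∑ x : Site (F.P K) 0, ∑ j : Fin 2, ∑ k : Fin 2,
            ‖(divB (torusT (F.P K) 0) (fun κ z => unitsField (toUField W) ⟨z, κ⟩) (fun κ z => Complex.I • D ⟨z, κ⟩) x) j k‖ ^ 2)))
    (hs4 : 4 * s ≤ 1) (hθ : 2 * e * (C₂ * (1 + ζ)) ≤ 1 / 8)
    (hsmall : 15552 * s ^ 2 + 216 * regThreshold F n K e + 2 * e * (C₁ + C₂ * ((F.L : ℝ) ^ (K - n)) ^ 2 * δ) * (((F.L : ℝ) ^ (K - n)) ^ 2)⁻¹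
      ≤ ((κ - δ / 4) / (1 + ζ / 4)) / 8) :
    IsMinOn (fun W' : GaugeField (F.P K) 0 (Matrix.specialUnitaryGroup (Fin 2) ℂ) => wilsonAction4 W') (regFibrePr F n K h e V) W := by
  have hreg : RegPr F n K e W := ((mem_regFibrePr_iff F).mp hWe).2
  have he0 : 0 < e := pos_of_regPr F hreg
  refine isMinOn_regFibrePr_of_linRows_at F h V hWe fun W' hW' => ?_
  obtain ⟨D, hDh, hDs, hA, hq, hsl, μ, hμ, hJ⟩ := hrows W' hW'
  -- THE GAUGED MULTIPLIER BOUND along `A := iD` (✓`abs_lin_le_sum_norm_trueLinIter_sub_coarseGauge`)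
  have hsk : ∀ b : PBond (F.P K) 0, (fun b => Complex.I • D b) b ∈ skewAdjoint (Matrix (Fin 2) (Fin 2) ℂ) := fun b => I_smul_mem_skewAdjoint (hDh b).1
  have htr : ∀ b : PBond (F.P K) 0, ((fun b => Complex.I • D b) b).trace = 0 := fun b => trace_I_smul_eq_zero (hDh b).2
  have hEL := abs_lin_le_sum_norm_trueLinIter_sub_coarseGauge F h hW he0 he hreg Q hQ0 hQs (fun b => Complex.I • D b) hsk htr
    μ (fun y => (hμ y).1) (fun y => (hμ y).2)
  beta_reduce at hEL
  -- THE (116) ARITHMETIC: the slice budget folds the divergence term into the curl term on both rows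
  set ℓ : ℝ := (F.L : ℝ) ^ (K - n) with hℓ
  have hL1 : (1 : ℝ) ≤ (F.L : ℝ) := by have := F.hL.2; exact_mod_cast (by omega : 1 ≤ F.L)
  have hℓ1 : 1 ≤ ℓ := one_le_pow₀ hL1
  have hℓ0 : 0 < ℓ := by linarith
  set Mm : ℝ := ∑ b : PBond (F.P K) 0, ‖D b‖ ^ 2 with hMm
  set Kc : ℝ := ∑ p : Plaq (F.P K) 0, ‖((Complex.I • D ⟨p.src, p.μ⟩) + ((W ⟨p.src, p.μ⟩ : Matrix (Fin 2) (Fin 2) ℂ) * (Complex.I • D ⟨p.src.shift p.μ, p.ν⟩) * star (W ⟨p.src, p.μ⟩ : Matrix (Fin 2) (Fin 2) ℂ))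
            - (((W ⟨p.src, p.μ⟩ * W ⟨p.src.shift p.μ, p.ν⟩ * (W ⟨p.src.shift p.ν, p.μ⟩)⁻¹ : Matrix.specialUnitaryGroup (Fin 2) ℂ) : Matrix (Fin 2) (Fin 2) ℂ) * (Complex.I • D ⟨p.src.shift p.ν, p.μ⟩) * star ((W ⟨p.src, p.μ⟩ * W ⟨p.src.shift p.μ, p.ν⟩ * (W ⟨p.src.shift p.ν, p.μ⟩)⁻¹ : Matrix.specialUnitaryGroup (Fin 2) ℂ) : Matrix (Fin 2) (Fin 2) ℂ))
            - (((GaugeField.plaqHol W p : Matrix.specialUnitaryGroup (Fin 2) ℂ) : Matrix (Fin 2) (Fin 2) ℂ) * (Complex.I • D ⟨p.src, p.ν⟩) * star ((GaugeField.plaqHol W p : Matrix.specialUnitaryGroup (Fin 2) ℂ) : Matrix (Fin 2) (Fin 2) ℂ)))‖ ^ 2 with hKc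
  set Dv : ℝ := ∑ x : Site (F.P K) 0, ∑ j : Fin 2, ∑ k : Fin 2,
            ‖(divB (torusT (F.P K) 0) (fun κ z => unitsField (toUField W) ⟨z, κ⟩) (fun κ z => Complex.I • D ⟨z, κ⟩) x) j k‖ ^ 2 with hDv
  have hMm0 : 0 ≤ Mm := Finset.sum_nonneg fun _ _ => sq_nonneg _
  have hKc0 : 0 ≤ Kc := Finset.sum_nonneg fun _ _ => sq_nonneg _
  have hDv0 : 0 ≤ Dv := Finset.sum_nonneg fun _ _ => Finset.sum_nonneg fun _ _ => Finset.sum_nonneg fun _ _ => sq_nonneg _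
  have hden : 0 < 1 + ζ / 4 := by linarith
  -- HESS in curl-only currency with the folded constant `κ′ = (κ − δ∕4)∕(1 + ζ∕4)`
  have hq' : (κ - δ / 4) / (1 + ζ / 4) * Mm ≤ Kc := by
    rw [div_mul_eq_mul_div, div_le_iff₀ hden]
    nlinarith [hq, hsl, hMm0, hKc0, hDv0]
  -- JOINT in curl-only currency with the folded constants `C₁′ = C₁ + C₂ℓ²δ`, `C₂′ = C₂(1 + ζ)`
  have hJ' : ∑ c : PBond (F.P K) (K - n), ‖Q (K - n) (fun b => Complex.I • D b) c
              - (μ c.src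
                - ((Averaging.iter (fun i => blockAvg (P := F.P K) (j := i) (expMeanLogSU (n := Fin 2))) (K - n) W c : Matrix.specialUnitaryGroup (Fin 2) ℂ) :
                    Matrix (Fin 2) (Fin 2) ℂ) * μ c.tgt
                  * star ((Averaging.iter (fun i => blockAvg (P := F.P K) (j := i) (expMeanLogSU (n := Fin 2))) (K - n) W c : Matrix.specialUnitaryGroup (Fin 2) ℂ) :
                    Matrix (Fin 2) (Fin 2) ℂ))‖
      ≤ (C₁ + C₂ * ℓ ^ 2 * δ) * ℓ⁻¹ * Mm + C₂ * (1 + ζ) * ℓ * Kc := by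
    refine hJ.trans ?_
    have e1 : (C₁ + C₂ * ℓ ^ 2 * δ) * ℓ⁻¹ * Mm + C₂ * (1 + ζ) * ℓ * Kc
        = C₁ * ℓ⁻¹ * Mm + C₂ * ℓ * ((1 + ζ) * Kc + δ * Mm) := by
      field_simp
      ring
    rw [e1]
    have h2 : C₂ * ℓ * (Kc + Dv) ≤ C₂ * ℓ * ((1 + ζ) * Kc + δ * Mm) :=
      mul_le_mul_of_nonneg_left (by linarith [hsl]) (by positivity)
    linarith [h2]
  exact ⟨D, s, hDh, hDs, hs4, hA, linRow_of_QRows F he0.le W D hEL hJ' hq' hθ (by linarith [hsmall])⟩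


/-! ## §2 The same with HESS discharged on the (0.4)-fibre -/

set_option maxHeartbeats 400000 in
/-- ★★★ **E′ AT A DATUM FROM CHART_W ∧ FIBRE MEMBERSHIP ∧ SLICE BUDGET ∧ THE JOINT ROW MODULO COARSE GAUGE — HESS DISCHARGED.**  As §1, but the (116) row is
PROVED for every competitor whose chart point lies on the SAME (0.4)-fibre (✓`Prop7HessWOfFibreCoreT3.hessW_curl_div_of_mem_fibre_T3`, ★routeR-w3 g3, with
`κ = ℓ⁻²∕(128(18 + 537600L⁴))`, windows `10¹⁴L⁹e ≤ 1`, `4·10¹¹L⁹(ℓs) ≤ 1`); displayed per competitor: the chart (`D`, `‖D(b)‖ ≤ s`, `A(W′) = A(e^{iD}W)`), the UNTWISTED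
fibre membership `e^{iD}W ∈ 𝔅_k(V)`, the SLICE budget `DIV ≤ ζK + δM`, and the JOINT row mod coarse gauge in `(K + DIV)` currency.  So on the untwisted chart the growth
side's residue is EXACTLY: chart + fibre membership (chart supplier), the slice's divergence budget, and the (n3) reduced-family row.
[cite: Balaban1985Variational, (141)-(143) p.299, (116) p.295, (47)-(48) pp.285-286, (6) p.278, (14) p.280; Balaban1985BackgroundPropagators, Thm 3.11 p.416] -/
theorem isMinOn_regFibrePr_of_fibreRows_at (F : T3Family) {n K : ℕ} (h : n ≤ K) {e s ζ δ C₁ C₂ : ℝ} (hζ : 0 ≤ ζ) (hC₂ : 0 ≤ C₂)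
    (V : GaugeField (F.P n) 0 (Matrix.specialUnitaryGroup (Fin 2) ℂ)) {W : GaugeField (F.P K) 0 (Matrix.specialUnitaryGroup (Fin 2) ℂ)}
    (hW : IsCritR2 F n K h V W) (hWe : W ∈ regFibrePr F n K h e V) (he : 100000000000000 * (F.L : ℝ) ^ 9 * e ≤ 1)
    (Q : (k : ℕ) → (PBond (F.P K) 0 → Matrix (Fin 2) (Fin 2) ℂ) → PBond (F.P K) k → Matrix (Fin 2) (Fin 2) ℂ) (hQ0 : ∀ Y, Q 0 Y = Y)
    (hQs : ∀ (k : ℕ) (Y : PBond (F.P K) 0 → Matrix (Fin 2) (Fin 2) ℂ) (c : PBond (F.P K) (k + 1)), Q (k + 1) Y c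
      = fderiv ℂ (eml : (Idx (F.P K) → Matrix (Fin 2) (Fin 2) ℂ) → Matrix (Fin 2) (Fin 2) ℂ)
            (fun i => ((loopHol (Averaging.iter (fun i => blockAvg (P := F.P K) (j := i) (expMeanLogSU (n := Fin 2))) k W) c i :
              Matrix.specialUnitaryGroup (Fin 2) ℂ) : Matrix (Fin 2) (Fin 2) ℂ))
            (fun i => covWalkSum (Averaging.iter (fun i => blockAvg (P := F.P K) (j := i) (expMeanLogSU (n := Fin 2))) k W) (Q k Y)
                (walk (emb c.src) (loopWord (F.P K).L c.dir (off i.1) i.2.1 i.2.2))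
              * ((loopHol (Averaging.iter (fun i => blockAvg (P := F.P K) (j := i) (expMeanLogSU (n := Fin 2))) k W) c i :
                Matrix.specialUnitaryGroup (Fin 2) ℂ) : Matrix (Fin 2) (Fin 2) ℂ))
            * star ((corr (expMeanLogSU (n := Fin 2)) (Averaging.iter (fun i => blockAvg (P := F.P K) (j := i) (expMeanLogSU (n := Fin 2))) k W) c :
                Matrix.specialUnitaryGroup (Fin 2) ℂ) : Matrix (Fin 2) (Fin 2) ℂ)
          + ((corr (expMeanLogSU (n := Fin 2)) (Averaging.iter (fun i => blockAvg (P := F.P K) (j := i) (expMeanLogSU (n := Fin 2))) k W) c :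
                Matrix.specialUnitaryGroup (Fin 2) ℂ) : Matrix (Fin 2) (Fin 2) ℂ)
            * covWalkSum (Averaging.iter (fun i => blockAvg (P := F.P K) (j := i) (expMeanLogSU (n := Fin 2))) k W) (Q k Y)
                (walk (emb c.src) (List.replicate (F.P K).L (c.dir, true)))
            * star ((corr (expMeanLogSU (n := Fin 2)) (Averaging.iter (fun i => blockAvg (P := F.P K) (j := i) (expMeanLogSU (n := Fin 2))) k W) c :
                Matrix.specialUnitaryGroup (Fin 2) ℂ) : Matrix (Fin 2) (Fin 2) ℂ))
    (hrows : ∀ W' : GaugeField (F.P K) 0 (Matrix.specialUnitaryGroup (Fin 2) ℂ), W' ∈ regFibrePr F n K h e V →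
        ∃ (D : PBond (F.P K) 0 → Matrix (Fin 2) (Fin 2) ℂ),
          (∀ b : PBond (F.P K) 0, (D b).IsHermitian ∧ Matrix.trace (D b) = 0) ∧ (∀ b : PBond (F.P K) 0, ‖D b‖ ≤ s) ∧
          wilsonAction4 W' = wilsonAction4 (emb15 W (expHermField D)) ∧
          emb15 W (expHermField D) ∈ fibre F ℰp n K h V ∧
          (∑ x : Site (F.P K) 0, ∑ j : Fin 2, ∑ k : Fin 2,
            ‖(divB (torusT (F.P K) 0) (fun κ z => unitsField (toUField W) ⟨z, κ⟩) (fun κ z => Complex.I • D ⟨z, κ⟩) x) j k‖ ^ 2)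
            ≤ ζ * (∑ p : Plaq (F.P K) 0, ‖((Complex.I • D ⟨p.src, p.μ⟩) + ((W ⟨p.src, p.μ⟩ : Matrix (Fin 2) (Fin 2) ℂ) * (Complex.I • D ⟨p.src.shift p.μ, p.ν⟩) * star (W ⟨p.src, p.μ⟩ : Matrix (Fin 2) (Fin 2) ℂ))
            - (((W ⟨p.src, p.μ⟩ * W ⟨p.src.shift p.μ, p.ν⟩ * (W ⟨p.src.shift p.ν, p.μ⟩)⁻¹ : Matrix.specialUnitaryGroup (Fin 2) ℂ) : Matrix (Fin 2) (Fin 2) ℂ) * (Complex.I • D ⟨p.src.shift p.ν, p.μ⟩) * star ((W ⟨p.src, p.μ⟩ * W ⟨p.src.shift p.μ, p.ν⟩ * (W ⟨p.src.shift p.ν, p.μ⟩)⁻¹ : Matrix.specialUnitaryGroup (Fin 2) ℂ) : Matrix (Fin 2) (Fin 2) ℂ))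
            - (((GaugeField.plaqHol W p : Matrix.specialUnitaryGroup (Fin 2) ℂ) : Matrix (Fin 2) (Fin 2) ℂ) * (Complex.I • D ⟨p.src, p.ν⟩) * star ((GaugeField.plaqHol W p : Matrix.specialUnitaryGroup (Fin 2) ℂ) : Matrix (Fin 2) (Fin 2) ℂ)))‖ ^ 2)
              + δ * ∑ b : PBond (F.P K) 0, ‖D b‖ ^ 2 ∧
          ∃ μ : Site (F.P K) (K - n) → Matrix (Fin 2) (Fin 2) ℂ, (∀ y, μ y ∈ skewAdjoint (Matrix (Fin 2) (Fin 2) ℂ) ∧ (μ y).trace = 0) ∧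
          ∑ c : PBond (F.P K) (K - n), ‖Q (K - n) (fun b => Complex.I • D b) c
              - (μ c.src
                - ((Averaging.iter (fun i => blockAvg (P := F.P K) (j := i) (expMeanLogSU (n := Fin 2))) (K - n) W c : Matrix.specialUnitaryGroup (Fin 2) ℂ) :
                    Matrix (Fin 2) (Fin 2) ℂ) * μ c.tgt
                  * star ((Averaging.iter (fun i => blockAvg (P := F.P K) (j := i) (expMeanLogSU (n := Fin 2))) (K - n) W c : Matrix.specialUnitaryGroup (Fin 2) ℂ) :
                    Matrix (Fin 2) (Fin 2) ℂ))‖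
            ≤ C₁ * ((F.L : ℝ) ^ (K - n))⁻¹ * ∑ b : PBond (F.P K) 0, ‖D b‖ ^ 2
              + C₂ * (F.L : ℝ) ^ (K - n) * ((∑ p : Plaq (F.P K) 0, ‖((Complex.I • D ⟨p.src, p.μ⟩) + ((W ⟨p.src, p.μ⟩ : Matrix (Fin 2) (Fin 2) ℂ) * (Complex.I • D ⟨p.src.shift p.μ, p.ν⟩) * star (W ⟨p.src, p.μ⟩ : Matrix (Fin 2) (Fin 2) ℂ))
            - (((W ⟨p.src, p.μ⟩ * W ⟨p.src.shift p.μ, p.ν⟩ * (W ⟨p.src.shift p.ν, p.μ⟩)⁻¹ : Matrix.specialUnitaryGroup (Fin 2) ℂ) : Matrix (Fin 2) (Fin 2) ℂ) * (Complex.I • D ⟨p.src.shift p.ν, p.μ⟩) * star ((W ⟨p.src, p.μ⟩ * W ⟨p.src.shift p.μ, p.ν⟩ * (W ⟨p.src.shift p.ν, p.μ⟩)⁻¹ : Matrix.specialUnitaryGroup (Fin 2) ℂ) : Matrix (Fin 2) (Fin 2) ℂ))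
            - (((GaugeField.plaqHol W p : Matrix.specialUnitaryGroup (Fin 2) ℂ) : Matrix (Fin 2) (Fin 2) ℂ) * (Complex.I • D ⟨p.src, p.ν⟩) * star ((GaugeField.plaqHol W p : Matrix.specialUnitaryGroup (Fin 2) ℂ) : Matrix (Fin 2) (Fin 2) ℂ)))‖ ^ 2)
                + (∑ x : Site (F.P K) 0, ∑ j : Fin 2, ∑ k : Fin 2,
            ‖(divB (torusT (F.P K) 0) (fun κ z => unitsField (toUField W) ⟨z, κ⟩) (fun κ z => Complex.I • D ⟨z, κ⟩) x) j k‖ ^ 2)))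
    (hs0 : 0 ≤ s) (hs4 : 4 * s ≤ 1) (hsL : 400000000000 * (F.L : ℝ) ^ 9 * (((F.L : ℝ) ^ (K - n)) * s) ≤ 1)
    (hθ : 2 * e * (C₂ * (1 + ζ)) ≤ 1 / 8)
    (hsmall : 15552 * s ^ 2 + 216 * regThreshold F n K e + 2 * e * (C₁ + C₂ * ((F.L : ℝ) ^ (K - n)) ^ 2 * δ) * (((F.L : ℝ) ^ (K - n)) ^ 2)⁻¹
      ≤ (((1 / (128 * (18 + 537600 * (F.L : ℝ) ^ 4))) * ((((F.L : ℝ) ^ (K - n))) ^ 2)⁻¹ - δ / 4) / (1 + ζ / 4)) / 8) :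
    IsMinOn (fun W' : GaugeField (F.P K) 0 (Matrix.specialUnitaryGroup (Fin 2) ℂ) => wilsonAction4 W') (regFibrePr F n K h e V) W := by
  have hL1 : (1 : ℝ) ≤ (F.L : ℝ) := by have := F.hL.2; exact_mod_cast (by omega : 1 ≤ F.L)
  -- the weaker window `10¹⁰L⁶e ≤ 1` of the door
  have he10 : 10 ^ 10 * (F.L : ℝ) ^ 6 * e ≤ 1 := by
    have he0 : 0 < e := pos_of_regPr F ((mem_regFibrePr_iff F).mp hWe).2
    have hmono : (10 : ℝ) ^ 10 * (F.L : ℝ) ^ 6 ≤ 100000000000000 * (F.L : ℝ) ^ 9 := by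
      have h6 : (F.L : ℝ) ^ 6 ≤ (F.L : ℝ) ^ 9 := pow_le_pow_right₀ hL1 (by norm_num)
      have h6' : (0 : ℝ) ≤ (F.L : ℝ) ^ 6 := by positivity
      nlinarith
    exact (mul_le_mul_of_nonneg_right hmono he0.le).trans he
  refine isMinOn_regFibrePr_of_gaugedRows116_at F h hζ hC₂ V hW hWe he10 Q hQ0 hQs (fun W' hW' => ?_) hs4 hθ hsmall
  obtain ⟨D, hDh, hDs, hA, hfibD, hsl, hJ⟩ := hrows W' hW'
  -- HESS116 DISCHARGED on the fibre: ✓`hessW_curl_div_of_mem_fibre_T3`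
  exact ⟨D, hDh, hDs, hA, hessW_curl_div_of_mem_fibre_T3 F h V hWe he D hDh hs0 hDs hsL hfibD, hsl, hJ⟩

end Summit.QuantumFields.YangMills.Theorems.Prop7LocMinOfGaugedRows116

end
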